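import Summits.ResolutionOfSingularities.ResolutionOfSingularities.Theorems.PurelyInseparableDim4ApproxCoordChange
import Summits.ResolutionOfSingularities.ResolutionOfSingularities.Theorems.PurelyInseparableDim4FreeTailLemma
import Summits.ResolutionOfSingularities.ResolutionOfSingularities.Theorems.PurelyInseparableDim4ExceptionalLength
import Mathlib.RingTheory.MvPolynomial.Ideal
import Mathlib.Algebra.Ring.GeomSum
import HarnessLib
import HarnessLib.Audit.Tags

/-!
# Purely inseparable four-folds — the SWAP IDENTITY: one closed point of a point blow-up in two charts (cell `res-dim4-pi`,
# K2(p) lane, brick «swap normalisation», FILE SN1)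

[OURS · counted 0 · cell `res-dim4-pi` · seat res-dim4-p-7 g3 · desk WORD #116 («swap normalisation», booked); consumers: the
d = 2 residue (`…ShadeTwoFrameWindowLocal`) and res-dim4-p-1 g3's K24a case F.]  Nothing here proves K2(p), `NoIsolatedTrap p p`,
or resolution of singularities in dimension ≥ 4 / characteristic `p`.  AI kernel work, weaker than expert review.

A step of the tree's walk blows up the origin and passes to the chart `x_j ≠ 0` at the point `b` (`b_j = 0`).  For letters
`a ≠ f` and `τ τ' = 1` the two data «chart `f`, translate `x_a` by `τ'`» (child `A`) and «chart `a`, translate `x_f` by `τ`»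
(child `B`) are ONE closed point `[… : τ' : … : 1] = [… : 1 : … : τ]` of the exceptional `ℙ³`; the coordinates differ by the
transition `x^A_f = x_a (x_f + τ)`, `x^A_i = x_i / (x_f + τ)` (`i ∉ {a, f}`), `x^A_a = −τ' x_f /(x_f + τ)` — rational with the unit
denominator `x_f + τ`.  Replacing `1/(x_f + τ)` by any inverse `P` MODULO `x_f^M` gives a POLYNOMIAL substitution `φ`, and:
* `swap_pointTransform_mem`: `(x_f + τ)^q · (T_A ∘ φ) − T_B ∈ (x_f^M)` for the two point transforms `T_A`, `T_B` of any `F`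
  with `ord₀ F ≥ q` (both sides times `x_a^q` are `F` at argument vectors congruent modulo `(x_f^M)`);
* `swap_step_F_mem`: the same for the CLEANED children, `B.F − clean((x_f + τ)^p · (A.F ∘ φ)) ∈ (x_f^M)` (cleaning kills
  `(x_f+τ)^p ·` (`p`-th powers) exactly); `swap_step_r`: the ledgers agree up to the transposition `(a f)`;
* `swap_subst_inv_mem`: the substitution built from an inverse of `x_a + τ'` modulo `x_a^M` inverts `φ` modulo `(x_f^M)` (and,
  by the symmetry `(a, f, τ, τ') ↔ (f, a, τ', τ)` of all statements, the other way round) — the data FILE SN2 consumes;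
* `exists_inv_mod_X_pow`: the geometric sum is such an inverse.
bears_on: LADDER-RESOLUTION:D157-DOOR2 (res-dim4-pi · K2(p) · swap normalisation SN1).  Supports
stmt-ResolutionOfSingularities-16155 (helper).
-/

set_option linter.dupNamespace false -- mandated namespace of this single-conjunct summit

noncomputable section

namespace Summit.ResolutionOfSingularities.ResolutionOfSingularities.Theorems.PIDim4

namespace SwapNorm

open MvPolynomial Finset
open Literature.AlgebraicGeometry.Resolution
open Literature.AlgebraicGeometry.Resolution.CentreBlowup
open Literature.AlgebraicGeometry.Resolution.Hauser2010
variable {K : Type} [Field K]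

/-! ## §1 The monomial ideal `(x_f^M)` -/

/-- Membership in `(x_f^M)` read on the support. [folklore] -/
theorem mem_span_X_pow_iff (f : Fin 4) (M : ℕ) (G : MvPolynomial (Fin 4) K) :
    G ∈ Ideal.span {(X f : MvPolynomial (Fin 4) K) ^ M} ↔ ∀ m ∈ G.support, M ≤ m f := by
  classical
  have h : ({(X f : MvPolynomial (Fin 4) K) ^ M} : Set (MvPolynomial (Fin 4) K)) =
      (fun s => monomial s (1 : K)) '' {Finsupp.single f M} := by
    rw [Set.image_singleton, X_pow_eq_monomial]
  rw [h, mem_ideal_span_monomial_image]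
  refine forall₂_congr fun m _ => ?_
  constructor
  · rintro ⟨_, rfl, hle⟩
    exact Finsupp.single_le_iff.mp hle
  · intro hle
    exact ⟨_, rfl, Finsupp.single_le_iff.mpr hle⟩

/-- Cleaning only deletes monomials, so it preserves `(x_f^M)`. [folklore] -/
theorem deletePthPowers_mem_span_X_pow (q : ℕ) {f : Fin 4} {M : ℕ} {G : MvPolynomial (Fin 4) K}
    (h : G ∈ Ideal.span {(X f : MvPolynomial (Fin 4) K) ^ M}) :
    deletePthPowers q G ∈ Ideal.span {(X f : MvPolynomial (Fin 4) K) ^ M} := by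
  classical
  rw [mem_span_X_pow_iff] at h ⊢
  intro m hm
  rw [MvPolynomial.mem_support_iff, coeff_deletePthPowers] at hm
  split_ifs at hm with hq
  · exact absurd rfl hm
  · exact h m (MvPolynomial.mem_support_iff.mpr hm)

/-- A power of another variable can be cancelled against `(x_f^M)`. [folklore] -/
theorem mem_span_X_pow_of_X_pow_mul_mem {a f : Fin 4} (haf : a ≠ f) (n : ℕ) {M : ℕ} {D : MvPolynomial (Fin 4) K}
    (h : (X a : MvPolynomial (Fin 4) K) ^ n * D ∈ Ideal.span {(X f : MvPolynomial (Fin 4) K) ^ M}) :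
    D ∈ Ideal.span {(X f : MvPolynomial (Fin 4) K) ^ M} := by
  classical
  rw [mem_span_X_pow_iff] at h ⊢
  intro m hm
  have hm' : Finsupp.single a n + m ∈ ((X a : MvPolynomial (Fin 4) K) ^ n * D).support := by
    rw [MvPolynomial.mem_support_iff, X_pow_eq_monomial, coeff_monomial_mul, one_mul]
    exact MvPolynomial.mem_support_iff.mp hm
  have := h _ hm'
  rwa [Finsupp.add_apply, Finsupp.single_apply, if_neg haf, zero_add] at this

/-! ## §2 An inverse of `x_f + τ` modulo `x_f^M` -/

/-- The geometric sum inverts `x_f + τ` modulo `x_f^M` (`τ ≠ 0`). [folklore] -/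
theorem exists_inv_mod_X_pow (f : Fin 4) {τ : K} (hτ : τ ≠ 0) (M : ℕ) :
    ∃ P : MvPolynomial (Fin 4) K, (X f + C τ) * P - 1 ∈ Ideal.span {(X f : MvPolynomial (Fin 4) K) ^ M} := by
  refine ⟨C τ⁻¹ * ∑ i ∈ Finset.range M, (C (-τ⁻¹) * X f) ^ i, ?_⟩
  have h1 : (X f + C τ) * (C τ⁻¹ * ∑ i ∈ Finset.range M, (C (-τ⁻¹) * X f) ^ i) =
      (1 - C (-τ⁻¹) * X f) * ∑ i ∈ Finset.range M, (C (-τ⁻¹) * X f : MvPolynomial (Fin 4) K) ^ i := by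
    have hc : (X f + C τ) * C τ⁻¹ = (1 - C (-τ⁻¹) * X f : MvPolynomial (Fin 4) K) := by
      rw [add_mul, ← C_mul, mul_inv_cancel₀ hτ, C_1, map_neg]; ring
    rw [← mul_assoc, hc]
  rw [h1, mul_neg_geom_sum, sub_sub_cancel_left, mul_pow, ← map_pow]
  exact Submodule.neg_mem _ (Ideal.mul_mem_left _ _ (Ideal.mem_span_singleton_self _))

/-! ## §3 The two blow-up substitutions are congruent after the transition -/

section Swap

variable {a f : Fin 4} {τ τ' : K} {M : ℕ} {P : MvPolynomial (Fin 4) K} {φ : Fin 4 → MvPolynomial (Fin 4) K}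

/-- `E := (x_f + τ)·P − 1`; the transition `φ` sends `A`'s blow-up substitution (chart `f`, point `τ' e_a`) to `B`'s
(chart `a`, point `τ e_f`) modulo `(x_f^M)`, letter by letter. [folklore] -/
theorem swap_subst_congr (haf : a ≠ f) (hττ' : τ * τ' = 1)
    (hP : (X f + C τ) * P - 1 ∈ Ideal.span {(X f : MvPolynomial (Fin 4) K) ^ M})
    (hφf : φ f = X a * (X f + C τ)) (hφa : φ a = -(C τ' * X f * P)) (hφi : ∀ i, i ≠ a → i ≠ f → φ i = X i * P)
    (i : Fin 4) :
    aeval φ (if i = f then (X f : MvPolynomial (Fin 4) K) else X f * (X i + C ((Pi.single a τ' : Fin 4 → K) i))) -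
      (if i = a then (X a : MvPolynomial (Fin 4) K) else X a * (X i + C ((Pi.single f τ : Fin 4 → K) i))) ∈
      Ideal.span {(X f : MvPolynomial (Fin 4) K) ^ M} := by
  set E : MvPolynomial (Fin 4) K := (X f + C τ) * P - 1 with hE
  have hCτ : C τ * C τ' = (1 : MvPolynomial (Fin 4) K) := by rw [← C_mul, hττ', C_1]
  by_cases hif : i = f
  · subst hif
    rw [if_pos rfl, if_neg (Ne.symm haf), Pi.single_eq_same, aeval_X, hφf, sub_self]
    exact Ideal.zero_mem _
  by_cases hia : i = a
  · subst hia
    rw [if_neg hif, if_pos rfl, Pi.single_eq_same, map_mul, map_add, aeval_X, aeval_X, aeval_C, algebraMap_eq, hφf, hφa]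
    have : X i * (X f + C τ) * (-(C τ' * X f * P) + C τ') - X i = (-(C τ' * X i * X f)) * E := by
      linear_combination (X i) * hCτ
    rw [this]
    exact Ideal.mul_mem_left _ _ hP
  · rw [if_neg hif, if_neg hia, Pi.single_eq_of_ne hia, Pi.single_eq_of_ne hif, C_0, add_zero, map_mul,
      aeval_X, aeval_X, hφf, hφi i hia hif]
    have : X a * (X f + C τ) * (X i * P) - X a * X i = (X a * X i) * E := by rw [hE]; ring
    rw [this]
    exact Ideal.mul_mem_left _ _ hP

/-- The transition fixes the origin. [folklore] -/
theorem swap_subst_origin (hφf : φ f = X a * (X f + C τ)) (hφa : φ a = -(C τ' * X f * P))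
    (hφi : ∀ i, i ≠ a → i ≠ f → φ i = X i * P) (i : Fin 4) : constantCoeff (φ i) = 0 := by
  by_cases hif : i = f
  · subst hif; rw [hφf, map_mul, constantCoeff_X, zero_mul]
  by_cases hia : i = a
  · subst hia; rw [hφa, map_neg, map_mul, map_mul, constantCoeff_X, mul_zero, zero_mul, neg_zero]
  · rw [hφi i hia hif, map_mul, constantCoeff_X, zero_mul]

/-- **THE SWAP IDENTITY (point transforms).**  For `ord F ≥ q`, `a ≠ f`, `τ τ' = 1` and any inverse `P` of `x_f + τ`
modulo `x_f^M`: `(x_f + τ)^q · φ(T_A) − T_B ∈ (x_f^M)`, where `T_A = translate_{τ' e_a} (chartTransform_f F)` and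
`T_B = translate_{τ e_f} (chartTransform_a F)` are the two point transforms and `φ` is the polynomial transition.
[cite: Hauser2010, §F (chart expressions of a point blowup)] [folklore] -/
theorem swap_pointTransform_mem (q : ℕ) {F : MvPolynomial (Fin 4) K} (hF : (q : ℕ∞) ≤ ordAlong Finset.univ F)
    (haf : a ≠ f) (hττ' : τ * τ' = 1)
    (hP : (X f + C τ) * P - 1 ∈ Ideal.span {(X f : MvPolynomial (Fin 4) K) ^ M})
    (hφf : φ f = X a * (X f + C τ)) (hφa : φ a = -(C τ' * X f * P)) (hφi : ∀ i, i ≠ a → i ≠ f → φ i = X i * P) :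
    (X f + C τ) ^ q * aeval φ (PointBlowup.translate (Pi.single a τ' : Fin 4 → K) (chartTransform q Finset.univ f F)) -
        PointBlowup.translate (Pi.single f τ : Fin 4 → K) (chartTransform q Finset.univ a F) ∈
      Ideal.span {(X f : MvPolynomial (Fin 4) K) ^ M} := by
  classical
  have hA := FreeTailProof.aeval_blowup_eq q f (Pi.single a τ' : Fin 4 → K) (Pi.single_eq_of_ne haf.symm _) F hF
  have hB := FreeTailProof.aeval_blowup_eq q a (Pi.single f τ : Fin 4 → K) (Pi.single_eq_of_ne haf _) F hF
  -- `φ(x_f^q T_A) = x_a^q (x_f+τ)^q φ(T_A)` and `φ ∘ θ_A ≡ θ_B`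
  have h1 : aeval φ (aeval (fun i => if i = f then (X f : MvPolynomial (Fin 4) K) else X f * (X i + C ((Pi.single a τ' : Fin 4 → K) i))) F) -
      aeval (fun i => if i = a then (X a : MvPolynomial (Fin 4) K) else X a * (X i + C ((Pi.single f τ : Fin 4 → K) i))) F ∈
      Ideal.span {(X f : MvPolynomial (Fin 4) K) ^ M} := by
    rw [ApproxCoordChange.aeval_aeval]
    exact ApproxCoordChange.aeval_sub_aeval_mem (fun i => swap_subst_congr haf hττ' hP hφf hφa hφi i) F
  rw [hA, hB, map_mul, map_pow, aeval_X, hφf, mul_pow, mul_assoc, ← mul_sub] at h1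
  exact mem_span_X_pow_of_X_pow_mul_mem haf q h1

end Swap

/-! ## §4 The cleaned children and their ledgers -/

section Step

variable (p : ℕ) [hp : Fact p.Prime] [CharP K p]

/-- **Cleaning kills `U^p ·` (`p`-th powers) through any substitution**: `clean (U^p · θ(clean G)) = clean (U^p · θ G)`.
[cite: Hauser2010, §G (cleaning)] [folklore] -/
theorem deletePthPowers_mul_aeval_deletePthPowers (U : MvPolynomial (Fin 4) K) (θ : Fin 4 → MvPolynomial (Fin 4) K)
    (G : MvPolynomial (Fin 4) K) :
    deletePthPowers p (U ^ p * aeval θ (deletePthPowers p G)) = deletePthPowers p (U ^ p * aeval θ G) := by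
  classical
  have hsplit : G = deletePthPowers p G + ∑ d ∈ G.support with IsPthPowerExponent p d, monomial d (coeff d G) := by
    conv_lhs => rw [G.as_sum]
    rw [← Finset.sum_filter_add_sum_filter_not G.support (IsPthPowerExponent p), add_comm]
    rfl
  conv_rhs => rw [hsplit]
  rw [map_add, mul_add, deletePthPowers_add, map_sum, Finset.mul_sum, CentreBlowup.deletePthPowers_finset_sum,
    Finset.sum_eq_zero, add_zero]
  intro d hd
  obtain ⟨Q, hQ⟩ := Straightening.aeval_monomial_eq_pow_of_isPthPowerExponent p θ (Finset.mem_filter.mp hd).2 (coeff d G)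
  rw [hQ, mul_smul_comm, ← mul_pow, Straightening.deletePthPowers_smul, Straightening.deletePthPowers_pow_char, smul_zero]

omit hp [CharP K p] in
/-- `clean (A − B) = clean A − clean B`. [folklore] -/
theorem deletePthPowers_sub' (q : ℕ) (A B : MvPolynomial (Fin 4) K) :
    deletePthPowers q (A - B) = deletePthPowers q A - deletePthPowers q B := by
  classical
  ext d
  rw [coeff_sub, coeff_deletePthPowers, coeff_deletePthPowers, coeff_deletePthPowers, coeff_sub]
  split_ifs <;> ring

variable [DecidableEq K] {a f : Fin 4} {τ τ' : K} {M : ℕ} {P : MvPolynomial (Fin 4) K} {φ : Fin 4 → MvPolynomial (Fin 4) K}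

/-- **THE SWAP IDENTITY (cleaned children).**  With `A := step p univ f (τ' e_a) s` (chart of `f`, translating `x_a`) and
`B := step p univ a (τ e_f) s` (chart of `a`, translating `x_f`), `ord s.F ≥ p`, `a ≠ f`, `τ τ' = 1`:
`B.F − clean((x_f + τ)^p · φ(A.F)) ∈ (x_f^M)`. [cite: Hauser2010, §§F–G] [folklore] -/
theorem swap_step_F_mem {s : State K} (hF : (p : ℕ∞) ≤ ordAlong Finset.univ s.F) (haf : a ≠ f) (hττ' : τ * τ' = 1)
    (hP : (X f + C τ) * P - 1 ∈ Ideal.span {(X f : MvPolynomial (Fin 4) K) ^ M})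
    (hφf : φ f = X a * (X f + C τ)) (hφa : φ a = -(C τ' * X f * P)) (hφi : ∀ i, i ≠ a → i ≠ f → φ i = X i * P) :
    (CentreBlowup.step p Finset.univ a (Pi.single f τ : Fin 4 → K) s).F -
        deletePthPowers p ((X f + C τ) ^ p *
          aeval φ (CentreBlowup.step p Finset.univ f (Pi.single a τ' : Fin 4 → K) s).F) ∈
      Ideal.span {(X f : MvPolynomial (Fin 4) K) ^ M} := by
  change deletePthPowers p (PointBlowup.translate (Pi.single f τ : Fin 4 → K) (chartTransform p Finset.univ a s.F)) -
      deletePthPowers p ((X f + C τ) ^ p *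
        aeval φ (deletePthPowers p (PointBlowup.translate (Pi.single a τ' : Fin 4 → K)
          (chartTransform p Finset.univ f s.F)))) ∈ _
  rw [deletePthPowers_mul_aeval_deletePthPowers, ← deletePthPowers_sub']
  have h := Submodule.neg_mem _ (swap_pointTransform_mem p hF haf hττ' hP hφf hφa hφi)
  rw [neg_sub] at h
  exact deletePthPowers_mem_span_X_pow p h

omit hp [CharP K p] in
/-- **The two ledgers agree up to the transposition `(a f)`** (`τ, τ' ≠ 0`): `B.r i = A.r (swap a f i)`.
[cite: Hauser2010, §F (transform D')] [folklore] -/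
theorem swap_step_r (q : ℕ) {s : State K} (haf : a ≠ f) (hτ : τ ≠ 0) (hτ' : τ' ≠ 0) (i : Fin 4) :
    (CentreBlowup.step q Finset.univ a (Pi.single f τ : Fin 4 → K) s).r i =
      (CentreBlowup.step q Finset.univ f (Pi.single a τ' : Fin 4 → K) s).r (Equiv.swap a f i) := by
  change newMult q Finset.univ a (Pi.single f τ : Fin 4 → K) s i =
    newMult q Finset.univ f (Pi.single a τ' : Fin 4 → K) s (Equiv.swap a f i)
  unfold newMult
  by_cases hia : i = a
  · subst hia
    rw [Equiv.swap_apply_left, Finsupp.update_apply, if_pos rfl, Finsupp.update_apply, if_pos rfl]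
  by_cases hif : i = f
  · subst hif
    rw [Equiv.swap_apply_right, Finsupp.update_apply, if_neg hia, Finsupp.filter_apply, Pi.single_eq_same,
      if_neg hτ, Finsupp.update_apply, if_neg haf, Finsupp.filter_apply, Pi.single_eq_same, if_neg hτ']
  · rw [Equiv.swap_apply_of_ne_of_ne hia hif, Finsupp.update_apply, if_neg hia, Finsupp.filter_apply,
      Pi.single_eq_of_ne hif, if_pos rfl, Finsupp.update_apply, if_neg hif, Finsupp.filter_apply,
      Pi.single_eq_of_ne hia, if_pos rfl]

end Step

/-! ## §5 The transition is invertible modulo `(x_f^M)` -/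

section Inverse

variable {a f : Fin 4} {τ τ' : K} {M : ℕ} {P P' : MvPolynomial (Fin 4) K} {φ ψ : Fin 4 → MvPolynomial (Fin 4) K}

/-- **`φ ∘ ψ ≡ id (mod x_f^M)`**: the transition `ψ` built symmetrically from an inverse `P'` of `x_a + τ'` modulo `x_a^M`
inverts `φ` modulo `(x_f^M)`; by the symmetry `(a, f, τ, τ', P, P') ↔ (f, a, τ', τ, P', P)` of the hypotheses the same
lemma gives `ψ ∘ φ ≡ id (mod x_a^M)`. [folklore] -/
theorem swap_subst_inv_mem (haf : a ≠ f) (hττ' : τ * τ' = 1)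
    (hP : (X f + C τ) * P - 1 ∈ Ideal.span {(X f : MvPolynomial (Fin 4) K) ^ M})
    (hP' : (X a + C τ') * P' - 1 ∈ Ideal.span {(X a : MvPolynomial (Fin 4) K) ^ M})
    (hφf : φ f = X a * (X f + C τ)) (hφa : φ a = -(C τ' * X f * P)) (hφi : ∀ i, i ≠ a → i ≠ f → φ i = X i * P)
    (hψa : ψ a = X f * (X a + C τ')) (hψf : ψ f = -(C τ * X a * P')) (hψi : ∀ i, i ≠ f → i ≠ a → ψ i = X i * P')
    (i : Fin 4) : aeval φ (ψ i) - X i ∈ Ideal.span {(X f : MvPolynomial (Fin 4) K) ^ M} := by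
  set E : MvPolynomial (Fin 4) K := (X f + C τ) * P - 1 with hE
  have hCτ : C τ * C τ' = (1 : MvPolynomial (Fin 4) K) := by rw [← C_mul, hττ', C_1]
  -- `φ` applied to `hP'`: `(φ a + τ') · φ(P') − 1 ∈ ((φ a)^M) ⊆ (x_f^M)`
  have hW0 : (φ a + C τ') * aeval φ P' - 1 ∈ Ideal.span {(X f : MvPolynomial (Fin 4) K) ^ M} := by
    have h := Ideal.mem_map_of_mem (aeval φ).toRingHom hP'
    rw [Ideal.map_span, Set.image_singleton] at h
    simp only [AlgHom.toRingHom_eq_coe, RingHom.coe_coe, map_sub, map_mul, map_add, map_one, map_pow, aeval_X, aeval_C,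
      algebraMap_eq] at h
    have hmem : φ a ^ M ∈ Ideal.span {(X f : MvPolynomial (Fin 4) K) ^ M} := by
      rw [hφa, neg_pow, mul_pow, mul_pow]
      exact Ideal.mul_mem_left _ _ (Ideal.mul_mem_right _ _ (Ideal.mul_mem_left _ _ (Ideal.mem_span_singleton_self _)))
    exact (Ideal.span_singleton_le_iff_mem _).mpr hmem h
  -- hence `W := P · φ(P') − 1 ∈ (x_f^M)` (`φ a + τ' = P − τ' E`)
  have hW : P * aeval φ P' - 1 ∈ Ideal.span {(X f : MvPolynomial (Fin 4) K) ^ M} := by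
    have : P * aeval φ P' - 1 = ((φ a + C τ') * aeval φ P' - 1) + (C τ' * aeval φ P') * E := by
      rw [hφa]; linear_combination (-(P * aeval φ P')) * hCτ
    rw [this]
    exact Ideal.add_mem _ hW0 (Ideal.mul_mem_left _ _ hP)
  by_cases hia : i = a
  · subst hia
    rw [hψa, map_mul, map_add, aeval_X, aeval_X, aeval_C, algebraMap_eq, hφf, hφa]
    have : X i * (X f + C τ) * (-(C τ' * X f * P) + C τ') - X i = (-(C τ' * X i * X f)) * E := by
      linear_combination (X i) * hCτ
    rw [this]
    exact Ideal.mul_mem_left _ _ hP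
  by_cases hif : i = f
  · subst hif
    rw [hψf, map_neg, map_mul, map_mul, aeval_C, algebraMap_eq, aeval_X, hφa]
    have : -(C τ * -(C τ' * X i * P) * aeval φ P') - X i = X i * (P * aeval φ P' - 1) := by
      linear_combination (X i * P * aeval φ P') * hCτ
    rw [this]
    exact Ideal.mul_mem_left _ _ hW
  · rw [hψi i hif hia, map_mul, aeval_X, hφi i hia hif]
    have : X i * P * aeval φ P' - X i = X i * (P * aeval φ P' - 1) := by ring
    rw [this]
    exact Ideal.mul_mem_left _ _ hW

end Inverse

end SwapNorm

end Summit.ResolutionOfSingularities.ResolutionOfSingularities.Theorems.PIDim4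

end
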